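import Literature.Computability.QuantumComplexity.TidyBlockFn
import Literature.Computability.QuantumComplexity.StageAbstract
import HarnessLib

/-!
# The abstract gate list of a tidy subroutine block, on codes

Topic `Literature/Computability/QuantumComplexity`; gen-11 module M3/S2(b) of the uniformity pipeline
(`AbstractGateUniform.lean`, `StageAbstract.lean`, `UniformAbstract.lean`). The tidy block around a
subroutine `S` on `k + d` wires (`TidyBlockFn.tidyCirc`: copy the query, run `S`, copy its answer register,
run `S⁻¹`, uncopy — Bennett–Bernstein–Brassard–Vazirani 1997, Thm. 4.14) abstracts to an explicit function of
`(k, ℓ, d)` and the abstract list of `S`: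

* `copyA`, `ansA`, **`tidyA k ℓ d SA`** (the subroutine's list renamed by `AGmap (k + ℓ + ·)`, its inverse word
  `AJLCore.invA`);
* **`map_toAG_tidyCirc`** — `(tidyCirc S).gates.map toAG = tidyA k ℓ d (S.gates.map toAG)`;
* `copyA_codeFP`, `ansA_codeFP`, **`tidyA_codeFP`** — `tidyA` on codes from `(k, ℓ, d)` (ranges capped by the unary
  first component) and the code of `SA` (with `AJLCore.invA_fp`).

No named fact is introduced.

HONEST FRAMING: the VALUE is a THEOREM (kernel-checked generic lemmas of KNOWN theory) — NOT summit progress;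
no trust base changes.

## References

* C. H. Bennett, E. Bernstein, G. Brassard, U. Vazirani, *Strengths and weaknesses of quantum computing*,
  SIAM J. Comput. 26 (1997), Thm. 4.14 (proof) [BennettBernsteinBrassardVazirani1997].
* S. Arora, B. Barak, *Computational Complexity: A Modern Approach*, CUP 2009, §6.2 and proof of Thm. 6.15
  [AroraBarak2009].
* M. A. Nielsen, I. L. Chuang, *Quantum Computation and Quantum Information*, CUP 2010, §4.2 (inverse circuits)
  [NielsenChuang2010].
-/

noncomputable section

namespace Literature.Computability.QuantumComplexity

open _root_.Computability Cryptography Complexity Complexity.CodeFP AJLCore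

namespace TidyBlockFn

variable {k ℓ d : ℕ}

/-! ### The abstract tidy block -/

/-- The abstract query copies: `CNOT` from wire `i` onto wire `off + i`, `i < k`. [cite: BennettBernsteinBrassardVazirani1997, Thm. 4.14 (proof)] -/
def copyA (k off : ℕ) : List AG := (List.range k).map fun i => ⟨.CNOT, [i, off + i]⟩

/-- The abstract answer copies: `CNOT` from wire `off + i` onto wire `k + i`, `i < ℓ` with `i < m`.
[cite: BennettBernsteinBrassardVazirani1997, Thm. 4.14 (proof)] -/
def ansA (ℓ m off k : ℕ) : List AG := (List.range ℓ).flatMap fun i => if i < m then [⟨.CNOT, [off + i, k + i]⟩] else []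

/-- **The abstract tidy block.** [cite: BennettBernsteinBrassardVazirani1997, Thm. 4.14 (proof)] -/
def tidyA (k ℓ d : ℕ) (SA : List AG) : List AG :=
  copyA k (k + ℓ) ++ (SA.map (AGmap (k + ℓ + ·)) ++ (ansA ℓ (k + d) (k + ℓ) k ++ ((invA SA).map (AGmap (k + ℓ + ·)) ++ copyA k (k + ℓ))))

/-- Abstraction of the query copies. [folklore] -/
theorem map_toAG_revCompile_copyOps : (revCompile (copyOps k ℓ d)).map toAG = copyA k (k + ℓ) := by
  rw [copyOps, copyOpsOf, revCompile, List.flatMap_map, List.map_flatMap, copyA, ← List.map_coe_finRange_eq_range, List.map_map,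
    List.map_eq_flatMap]
  exact List.flatMap_congr fun i _ => by simp [RevOp.compile, val_qW, val_dE]

/-- Abstraction of one answer copy. [folklore] -/
theorem map_toAG_revCompile_ansOp (i : Fin ℓ) :
    (revCompile (ansOp (k := k) (d := d) i)).map toAG = if (i : ℕ) < k + d then [⟨.CNOT, [k + ℓ + i, k + i]⟩] else [] := by
  unfold ansOp
  by_cases h : (i : ℕ) < k + d
  · rw [dif_pos h, if_pos h]; simp [revCompile, RevOp.compile, val_aW, val_dE]
  · rw [dif_neg h, if_neg h]; rfl

/-- Abstraction of the answer copies. [folklore] -/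
theorem map_toAG_revCompile_ansOps : (revCompile (ansOps k ℓ d)).map toAG = ansA ℓ (k + d) (k + ℓ) k := by
  rw [ansOps, ansOpsOf, revCompile, List.flatMap_assoc, List.map_flatMap, ansA, ← List.map_coe_finRange_eq_range, List.flatMap_map]
  exact List.flatMap_congr fun i _ => map_toAG_revCompile_ansOp i

/-- **The tidy block abstracts to `tidyA`.** [cite: BennettBernsteinBrassardVazirani1997, Thm. 4.14 (proof)] [cite: AroraBarak2009, §6.2] -/
theorem map_toAG_tidyCirc (S : QCircuit cliffordT (k + d)) :
    (tidyCirc (ℓ := ℓ) S).gates.map toAG = tidyA k ℓ d (S.gates.map toAG) := by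
  have hf : ∀ w : Fin (k + d), (fun x => k + ℓ + x) (w : ℕ) = (dE k ℓ d w : ℕ) := fun w => (val_dE w).symm
  show (tidyGates S).map toAG = _
  rw [tidyGates, List.map_append, List.map_append, List.map_append, List.map_append, map_toAG_revCompile_copyOps,
    map_toAG_mapWires (dE k ℓ d) _ hf, map_toAG_revCompile_ansOps, map_toAG_mapWires (dE k ℓ d) _ hf, map_toAG_inv, tidyA]

/-! ### On codes -/

/-- The query copies on codes: input `(cap, k, off)`, range capped by the unary `cap`. [cite: AroraBarak2009, §6.2] -/
theorem copyA_codeFP : CodeFP (pairE unE (pairE natE natE)) (rawE agE0) (fun p => copyA (min p.2.1 p.1) p.2.2) := by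
  have hg : CodeFP (pairE (pairE unE (pairE natE natE)) natE) agE0 (fun c => (⟨.CNOT, [c.2, c.1.2.2 + c.2]⟩ : AG)) :=
    ag_CX (snd _ _) ((natAdd.comp ((fst _ _).snd'.snd'.pair (snd _ _))) :)
  exact ((map hg).comp ((CodeFP.id _).pair (rangeOf.comp ((fst _ _).pair (snd _ _).fst')))).congr fun _ => rfl

/-- The answer copies on codes: input `(cap, ℓ, m, off, k)`, range capped by the unary `cap`. [cite: AroraBarak2009, §6.2] -/
theorem ansA_codeFP : CodeFP (pairE unE (pairE natE (pairE natE (pairE natE natE)))) (rawE agE0)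
    (fun p => ansA (min p.2.1 p.1) p.2.2.1 p.2.2.2.1 p.2.2.2.2) := by
  have hP : CodeFP (pairE (pairE unE (pairE natE (pairE natE (pairE natE natE)))) natE) (pairE natE (pairE natE (pairE natE natE)))
      (fun c => c.1.2) := (fst _ _).snd'
  have hi : CodeFP (pairE (pairE unE (pairE natE (pairE natE (pairE natE natE)))) natE) natE (fun c => c.2) := snd _ _
  have hitem : CodeFP (pairE (pairE unE (pairE natE (pairE natE (pairE natE natE)))) natE) (rawE agE0)
      (fun c => if c.2 < c.1.2.2.1 then [(⟨.CNOT, [c.1.2.2.2.1 + c.2, c.1.2.2.2.2 + c.2]⟩ : AG)] else []) :=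
    iteProp (natLt.comp (hi.pair hP.snd'.fst') :)
      (agList1 (ag_CX ((natAdd.comp (hP.snd'.snd'.fst'.pair hi)) :) ((natAdd.comp (hP.snd'.snd'.snd'.pair hi)) :)))
      (const _ [])
  have h : CodeFP (pairE unE (pairE natE (pairE natE (pairE natE natE)))) (rawE (rawE agE0))
      (fun p => (List.range (min p.2.1 p.1)).map fun i =>
        if i < p.2.2.1 then [(⟨.CNOT, [p.2.2.2.1 + i, p.2.2.2.2 + i]⟩ : AG)] else []) :=
    ((map hitem).comp ((CodeFP.id _).pair (rangeOf.comp ((fst _ _).pair (snd _ _).fst'))) :)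
  exact ((flatten agE0).comp h).congr fun _ => rfl

/-- **The abstract tidy block on codes**: input `((cap, k, ℓ, d), SA)`, ranges capped by the unary `cap` (the
statement is about `tidyA (min k cap) (min ℓ cap) d SA`; in use `cap ≥ k, ℓ`). [cite: AroraBarak2009, §6.2 and proof of Thm. 6.15] -/
theorem tidyA_codeFP : CodeFP (pairE (pairE unE (pairE natE (pairE natE natE))) (rawE agE0)) (rawE agE0)
    (fun p => tidyA (min p.1.2.1 p.1.1) (min p.1.2.2.1 p.1.1) p.1.2.2.2 p.2) := by
  have hcap : CodeFP (pairE (pairE unE (pairE natE (pairE natE natE))) (rawE agE0)) unE (fun p => p.1.1) := (fst _ _).fst'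
  have hk : CodeFP (pairE (pairE unE (pairE natE (pairE natE natE))) (rawE agE0)) natE (fun p => min p.1.2.1 p.1.1) :=
    ((natOfUn.comp unOfNatMin).comp (hcap.pair (fst _ _).snd'.fst') :)
  have hl : CodeFP (pairE (pairE unE (pairE natE (pairE natE natE))) (rawE agE0)) natE (fun p => min p.1.2.2.1 p.1.1) :=
    ((natOfUn.comp unOfNatMin).comp (hcap.pair (fst _ _).snd'.snd'.fst') :)
  have hd : CodeFP (pairE (pairE unE (pairE natE (pairE natE natE))) (rawE agE0)) natE (fun p => p.1.2.2.2) := (fst _ _).snd'.snd'.snd'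
  have hSA : CodeFP (pairE (pairE unE (pairE natE (pairE natE natE))) (rawE agE0)) (rawE agE0) (fun p => p.2) := snd _ _
  have hoff : CodeFP (pairE (pairE unE (pairE natE (pairE natE natE))) (rawE agE0)) natE
      (fun p => min p.1.2.1 p.1.1 + min p.1.2.2.1 p.1.1) := (natAdd.comp (hk.pair hl) :)
  -- the five segments
  have h1 : CodeFP (pairE (pairE unE (pairE natE (pairE natE natE))) (rawE agE0)) (rawE agE0)
      (fun p => copyA (min p.1.2.1 p.1.1) (min p.1.2.1 p.1.1 + min p.1.2.2.1 p.1.1)) :=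
    ((copyA_codeFP.comp (hcap.pair (hk.pair hoff))).congr fun p => by
      show copyA (min (min p.1.2.1 p.1.1) p.1.1) (min p.1.2.1 p.1.1 + min p.1.2.2.1 p.1.1) =
        copyA (min p.1.2.1 p.1.1) (min p.1.2.1 p.1.1 + min p.1.2.2.1 p.1.1)
      rw [min_eq_left (min_le_right p.1.2.1 p.1.1)])
  have hf : CodeFP (pairE (pairE (pairE unE (pairE natE (pairE natE natE))) (rawE agE0)) natE) natE
      (fun q => (min q.1.1.2.1 q.1.1.1 + min q.1.1.2.2.1 q.1.1.1) + q.2) := (natAdd.comp ((hoff.comp (fst _ _)).pair (snd _ _)) :)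
  have hmap : ∀ {L : (ℕ × ℕ × ℕ × ℕ) × List AG → List AG},
      CodeFP (pairE (pairE unE (pairE natE (pairE natE natE))) (rawE agE0)) (rawE agE0) L →
      CodeFP (pairE (pairE unE (pairE natE (pairE natE natE))) (rawE agE0)) (rawE agE0)
        (fun p => (L p).map (AGmap (min p.1.2.1 p.1.1 + min p.1.2.2.1 p.1.1 + ·))) := fun hL =>
    ((mapAGmap_codeFP (f := fun c w => min c.1.2.1 c.1.1 + min c.1.2.2.1 c.1.1 + w) hf).comp ((CodeFP.id _).pair hL)).congr
      fun _ => rfl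
  have h2 := hmap hSA
  have h3 : CodeFP (pairE (pairE unE (pairE natE (pairE natE natE))) (rawE agE0)) (rawE agE0)
      (fun p => ansA (min p.1.2.2.1 p.1.1) (min p.1.2.1 p.1.1 + p.1.2.2.2) (min p.1.2.1 p.1.1 + min p.1.2.2.1 p.1.1) (min p.1.2.1 p.1.1)) :=
    ((ansA_codeFP.comp (hcap.pair (hl.pair ((natAdd.comp (hk.pair hd) :).pair (hoff.pair hk))))).congr fun p => by
      show ansA (min (min p.1.2.2.1 p.1.1) p.1.1) (min p.1.2.1 p.1.1 + p.1.2.2.2) (min p.1.2.1 p.1.1 + min p.1.2.2.1 p.1.1)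
          (min p.1.2.1 p.1.1) = ansA (min p.1.2.2.1 p.1.1) (min p.1.2.1 p.1.1 + p.1.2.2.2)
          (min p.1.2.1 p.1.1 + min p.1.2.2.1 p.1.1) (min p.1.2.1 p.1.1)
      rw [min_eq_left (min_le_right p.1.2.2.1 p.1.1)])
  have hinv : CodeFP (pairE (pairE unE (pairE natE (pairE natE natE))) (rawE agE0)) (rawE agE0) (fun p => invA p.2) :=
    invA_fp.comp hSA
  have h4 := hmap hinv
  exact (agAppend h1 (agAppend h2 (agAppend h3 (agAppend h4 h1)))).congr fun _ => rfl

end TidyBlockFn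

end Literature.Computability.QuantumComplexity

end
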